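import Summits.BirchSwinnertonDyer.BirchSwinnertonDyer.Theorems.CongruentShaFreeCutTwoAdicLinks
import Summits.BirchSwinnertonDyer.BirchSwinnertonDyer.Theorems.CongruentShaFreeCutDescentField
import Summits.BirchSwinnertonDyer.BirchSwinnertonDyer.Theorems.CongruentShaFreeCutRankPosSquarefreeReduction
import Summits.BirchSwinnertonDyer.BirchSwinnertonDyer.Theorems.CongruentShaFreeCutAssembly
import Literature.NumberTheory.EllipticCurves.BSDSelmerCMPConverseRankOneProofs


/-! # Route `CongruentShaFreeCut` (rung S2) — crux `RankPosOfTwoSelmerCorankOne`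
(stmt-BirchSwinnertonDyer-19079, the route's declared RESIDUAL conjunct): the Ш-freeness half SPLIT
WITH TEETH in MODULE CURRENCY — Link A in CORANK form (named here, OPEN) + the typer's Link B
(`CongruentShaFreeCutTwoAdicLinks.TwoAdicCharValueEqHeegnerLogSq`, shared with crux B) ⟹ crux A,
and with it the whole rung-S2 leaf from the TWO typed links plus refereed facts (PROVED compositions)

Cell `bsd-cn100`, seat `bsd-cn100-transfer-2` g2; companion of the ALTERNATIVE crux-A skeleton
`heegner-field-links` (HOME/bsd-cn100-transfer-2/RankPosOfTwoSelmerCorankOne_heegnerFieldLinks_v3.lean,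
evidence #11 on the item). Supports, does not close, stmt-BirchSwinnertonDyer-19079. HONEST FRAMING:
nothing here proves crux A, crux B, the leaf `rankOne_twoConverse_congruentNumber` or any case of
BSD; ONE further open statement is NAMED (`@[conjecture] def`, nothing asserted) and the compositions
are PROVED.

## The corank link (the converse-theorem step)

The typer's file `Theorems/CongruentShaFreeCutTwoAdicLinks.lean` (bsd-cn100-ty g2) splits crux B's
research stub over Castella's typed `Λ`-module `𝔛 = AcSelmer.XAc ((E_n)_K) 2 κ v̄ ∅ γ` (auxiliary
imaginary quadratic `K` with the Heegner hypothesis for `N(E_n)` in which `2 = v v̄` SPLITS; `E_n`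
is still ADDITIVE at `2`) into Link A `TwoAdicControlOfRankOne` (`rank E_n(K) = 1 ∧ #Ш[2^∞] < ∞ ⟹
F(0) ≠ 0` for a characteristic generator `F`) and Link B `TwoAdicCharValueEqHeegnerLogSq` (corank one
⟹ `F(0) = u·log_ω(P)²`, `u ≠ 0`, for Heegner points `P`). For crux A the hypothesis is
`corank_{ℤ₂} Sel_{2^∞}(E_n/ℚ) = 1`, which descends (2-parity + Hoffstein–Luo + modularity + Kato:
`CongruentShaFreeCutDescentField.descentField_of_parity_of_hoffsteinLuo_of_kato`, p412958) to
`corank_{ℤ₂} Sel_{2^∞}(E_n/K) = 1` over such a `K`; so the algebraic link crux A needs is Link A with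
its hypothesis WEAKENED from "rank one and Ш-finite" to "corank one":

* `TwoAdicControlOfCorankOne` — `corank_{ℤ₂} Sel_{2^∞}(E_n/K) = 1 ⟹ ∃ m, XAc.HasCharValuationAt … m`
  (same binders as the typer's Link A). This is exactly the step where a CONVERSE theorem does its
  work — it excludes "corank one carried by Ш" — and is the shape of the control step of Skinner's
  converse (Ann. of Math. 191 (2020)), of CGLS 2022 §5.2 (proof of Thm. 5.2.1) and of Burungale–Tian
  2020 (CM, good ordinary); OPEN at the additive prime `2` (the `ℚ(i)`-analogue is Fan–Wan v2 §§5–6,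
  unrefereed). It IMPLIES the typer's Link A (`twoAdicControlOfRankOne_of_corankOne`: rank one and
  finite `Ш[2^∞]` give corank one, `selmerCorank_eq_one_of_mordellWeilRank_eq_one_of_finite`).

## What is PROVED

* `heegnerPointSupply_of_gross` — the skeleton's `stub_heegnerPointSupply` from the refereed fact
  `exists_isHeegnerPoint` (Gross 1984), binder-carrying form.
* `twoAdicControlOfRankOne_of_corankOne` — corank link ⟹ rank link.
* **`rankPos_squarefree_of_twoAdicLinks`**, **`cruxA_of_twoAdicLinks`** — crux A (on square-free
  `n`, then for all `n ≠ 0` by `rankPosOfTwoSelmerCorankOne_of_squarefree`, p419178) from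
  `2`-parity (`hpar`), modularity (`hmod`), Hoffstein–Luo (`hHL`), Kato (`hKato`), Gross's Heegner
  points (`hHP`) and the two links `hA : TwoAdicControlOfCorankOne`, `hB : TwoAdicCharValueEqHeegnerLogSq`:
  descend to `K`; take a Heegner point `P`; produce the anticyclotomic datum (b2b CGLS adapter:
  `X11b.exists_anticyclotomic_generator_degreeOnePrime`, `embAt`, `exists_other_prime`); the links give
  `F_A(0) ≠ 0` and `F_B(0) = u·log²` for generators of ONE principal ideal, so `log_ω(m₀•P_ι) ≠ 0`
  and `P` is not torsion (`AcPConverseLinks.not_isOfFinAddOrder_of_links`, AEC IV.6.4 / VII.2.2 — no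
  height, no regulator); Mordell–Weil gives `1 ≤ rank E_n(K) = rank E_n(ℚ)`.
* **`leaf_of_twoAdicLinks`** — the rung-S2 leaf `rankOne_twoConverse_congruentNumber` from the SAME
  two links (corank form of A) + Gross–Zagier–Kolyvagin-type facts, through the typer's
  `cruxB_of_twoAdicLinks`, the corank⟹rank implication and the route's `Assembly`
  (`CongruentShaFreeCutAssembly.assembly_holds`): the whole route reduces to TWO typed open
  statements over real objects plus refereed named facts. CONDITIONAL; credits nothing.

PARTITION: none (RANK axis). BSD is not touched by any of this.

References: [Skinner2020Converse] Thm. 1.1 (shape of the control step); [CastellaGrossiLeeSkinner2022]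
Thm. 5.1.1, §5.2; [Castella2018] Def. 2.2, Thm. 2.3, Thm. 3.2; [BertoliniDarmonPrasanna2013] Thm. 5.13;
[Gross1984] §§3–4; [Kato2004] Cor. 14.3; [DokchitserDokchitserAnnals2010] Thm. 1.4;
[SilvermanAEC2009] IV.6.4, VII.2.2. -/

noncomputable section

open scoped Classical

namespace Summit.BirchSwinnertonDyer.BirchSwinnertonDyer.Theorems.CongruentShaFreeCutTwoAdicLinksCorank

open WeierstrassCurve NumberField IsDedekindDomain Field Literature.NumberTheory.EllipticCurves
  Literature.NumberTheory.EllipticCurves.Castella2018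
open Summit.BirchSwinnertonDyer.BirchSwinnertonDyer.Theses.CongruentShaFreeCut
open Summit.BirchSwinnertonDyer.BirchSwinnertonDyer.Theorems.CongruentShaFreeCutTwoAdicLinks
  (TwoAdicControlOfRankOne TwoAdicCharValueEqHeegnerLogSq cruxB_of_twoAdicLinks)

/-! ## 1. The corank link (OPEN; named, nothing asserted) -/

/-- **Link A in CORANK currency — anticyclotomic control for `E_n` at the ADDITIVE prime `2`,
`p`-converse form.** For square-free `n`, an imaginary quadratic `K` with the Heegner hypothesis for
`N = N(E_n)` and with `2 = v v̄` split, an embedding `ι : K ↪ ℚ₂` inducing `v`, the anticyclotomic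
`ℤ₂`-extension `κ` of `K` with topological generator `γ`: if `corank_{ℤ₂} Sel_{2^∞}(E_n/K) = 1`, then
the dual Selmer group `𝔛 = X_ac(E_n[2^∞])` over `K_∞` (relaxed at `v`, strict at `v̄`; `AcSelmer.XAc`)
is `Λ`-torsion and a generator `F` of its characteristic ideal has `F(0) ≠ 0` — in the tree's
currency `AcSelmer.XAc.HasCharValuationAt … m` for SOME `m`. Same binders as the typer's
`TwoAdicControlOfRankOne` with the hypothesis "rank one and `Ш[2^∞]` finite" WEAKENED to "corank
one" (so this IMPLIES that link, `twoAdicControlOfRankOne_of_corankOne`); it is the control step of a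
`p`-CONVERSE theorem (excluding corank carried by Ш). SHAPE of the control step in Skinner 2020
(Thm. 1.1, good ordinary `p`, with a local non-degeneracy hypothesis), CGLS 2022 §5.2 (proof of
Thm. 5.2.1, good Eisenstein `p > 2`), Burungale–Tian 2020 (CM, good ordinary); OPEN at the additive
prime `2` (Fan–Wan v2 §§5–6 address the `ℚ(i)`-analogue at the ramified prime, unrefereed).
Research-grade; nothing asserted; strictly weaker than crux A (no Heegner point, no `L`-value).
[cite: CastellaGrossiLeeSkinner2022, Thm. 5.1.1 and §5.2 (shape only; nothing asserted)]
[cite: Castella2018, Def. 2.2 and Thm. 2.3 (arXiv:1704.06608 p. 5) (shape only; nothing asserted)] -/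
@[conjecture] def TwoAdicControlOfCorankOne : Prop :=
  ∀ ⦃n : ℕ⦄, Squarefree n → ∀ (K : Type) [Field K] [NumberField K] (N : ℕ) [NeZero N],
    (congruentNumberCurve n).conductorNorm ℤ = N → IsImaginaryQuadratic K →
      SatisfiesHeegnerHypothesis N K → SatisfiesHeegnerHypothesis 2 K →
    ∀ (ι : K →+* ℚ_[2]) (v vbar : HeightOneSpectrum (𝓞 K)),
      (∀ x : 𝓞 K, x ∈ v.asIdeal ↔ ‖ι (x : K)‖ < 1) →
      ((2 : ℕ) : 𝓞 K) ∈ vbar.asIdeal → vbar ≠ v →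
    ∀ (κ : ZpExtension K 2), κ.IsAnticyclotomic →
    ∀ (γ : absoluteGaloisGroup K) [Fact (κ.IsTopGenerator γ)],
      ((congruentNumberCurve n).baseChange K).selmerCorank 2 = 1 →
      ∃ m : ℕ, AcSelmer.XAc.HasCharValuationAt ((congruentNumberCurve n).baseChange K) 2 κ vbar ∅ γ m

/-! ## 2. Small companions (PROVED) -/

/-- **The corank link implies the typer's rank link**: `rank E_n(K) = 1 ∧ #Ш(E_n/K)[2^∞] < ∞` gives
`corank_{ℤ₂} Sel_{2^∞}(E_n/K) = 1` (`selmerCorank_eq_one_of_mordellWeilRank_eq_one_of_finite`: corank =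
rank + corank Ш). [cite: CastellaGrossiLeeSkinner2022, §5.2 (shape only)] -/
theorem twoAdicControlOfRankOne_of_corankOne (hA : TwoAdicControlOfCorankOne) :
    TwoAdicControlOfRankOne := by
  intro n hsq K _ _ N _ hN hK hHN hH2 ι v vbar hv hvbar hne κ hκ γ _ hrank hsha
  haveI := isElliptic_congruentNumberCurve hsq.ne_zero
  haveI : ((congruentNumberCurve n).baseChange K).IsElliptic := by rw [baseChange]; infer_instance
  exact hA hsq K N hN hK hHN hH2 ι v vbar hv hvbar hne κ hκ γ
    (selmerCorank_eq_one_of_mordellWeilRank_eq_one_of_finite _ 2 hrank hsha)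

/-- **Heegner points exist on `E_n` over a Heegner field** — the skeleton's `stub_heegnerPointSupply`
from the refereed named fact `exists_isHeegnerPoint` (Gross 1984 §§3–4), binder-carrying form
(`y² = x³ − n²x` is globally minimal for square-free `n`). [cite: Gross1984, §§3–4] -/
theorem heegnerPointSupply_of_gross
    (hHP : ∀ (W : WeierstrassCurve ℚ) (K : Type) [Field K] [NumberField K],
      exists_isHeegnerPoint W K) :
    ∀ ⦃n : ℕ⦄, Squarefree n → ∀ (K : Type) [Field K] [NumberField K] (N : ℕ) [NeZero N],
      (congruentNumberCurve n).conductorNorm ℤ = N → IsImaginaryQuadratic K →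
        SatisfiesHeegnerHypothesis N K →
          ∃ P : ((congruentNumberCurve n).baseChange K).toAffine.Point,
            IsHeegnerPoint N (congruentNumberCurve n) K P := by
  intro n hsq K _ _ N _ hN hK hHN
  haveI := isElliptic_congruentNumberCurve hsq.ne_zero
  haveI := isGloballyMinimal_congruentNumberCurve hsq
  subst hN
  exact hHP (congruentNumberCurve n) K hK hHN

/-! ## 3. Crux A from the two links (PROVED compositions) -/

/-- **Crux A on square-free `n` from the corank link, the typer's Link B and five refereed facts**
(`2`-parity, modularity, Hoffstein–Luo, Kato, Gross's Heegner points). Proof: module docstring.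
[cite: CastellaGrossiLeeSkinner2022, §5.2 (proof of Thm. 5.2.1: the shape of a BDP-type p-converse)]
[cite: SilvermanAEC2009, IV.6.4 and VII.2.2] -/
theorem rankPos_squarefree_of_twoAdicLinks
    (hpar : ∀ (W : WeierstrassCurve ℚ) [W.IsElliptic] (p : ℕ) [Fact p.Prime], p_parity W p)
    (hmod : ModularForms.exists_isNewformOf) (hHL : HoffsteinLuo1997_exists_twist_L_one_ne_zero)
    (hKato : ∀ (W : WeierstrassCurve ℚ) [W.IsElliptic] (p : ℕ) [Fact p.Prime],
      kato_finite_of_L_one_ne_zero W p)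
    (hHP : ∀ (W : WeierstrassCurve ℚ) (K : Type) [Field K] [NumberField K],
      exists_isHeegnerPoint W K)
    (hA : TwoAdicControlOfCorankOne) (hB : TwoAdicCharValueEqHeegnerLogSq) :
    ∀ ⦃n : ℕ⦄, Squarefree n → (congruentNumberCurve n).selmerCorank 2 = 1 →
      1 ≤ (congruentNumberCurve n).mordellWeilRank := by
  intro n hsq hc
  haveI := isElliptic_congruentNumberCurve hsq.ne_zero
  haveI := isGloballyMinimal_congruentNumberCurve hsq
  haveI : NeZero ((congruentNumberCurve n).conductorNorm ℤ) :=
    ⟨((congruentNumberCurve n).conductorNorm_pos_holds).ne'⟩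
  -- the descent field
  obtain ⟨K, _, _, hK, hHN, hH2, hcK, hrk⟩ :=
    CongruentShaFreeCutDescentField.descentField_of_parity_of_hoffsteinLuo_of_kato hpar hmod hHL hKato
      hsq.ne_zero hc
  -- a Heegner point
  obtain ⟨P, hP⟩ :=
    heegnerPointSupply_of_gross hHP hsq K ((congruentNumberCurve n).conductorNorm ℤ) rfl hK hHN
  -- the anticyclotomic datum
  obtain ⟨κ, γ, 𝔭, hκ, hγ, h𝔭, he, hf⟩ :=
    Summit.BirchSwinnertonDyer.Rank1Residual.X11b.exists_anticyclotomic_generator_degreeOnePrime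
      2 K hK hH2
  haveI : Fact (κ.IsTopGenerator γ) := ⟨hγ⟩
  let ι : K →+* ℚ_[2] := Summit.BirchSwinnertonDyer.Rank1Residual.X11b.embAt K 2 𝔭 h𝔭 he hf
  obtain ⟨vbar, hvbar, hne⟩ :=
    Summit.BirchSwinnertonDyer.Rank1Residual.X11b.exists_other_prime hH2
      (Summit.BirchSwinnertonDyer.Rank1Residual.X11b.inducedPlace ι)
      (Summit.BirchSwinnertonDyer.Rank1Residual.X11b.natCast_mem_inducedPlace ι)
  have hv := Summit.BirchSwinnertonDyer.Rank1Residual.X11b.mem_inducedPlace_iff ι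
  -- the two links force `P` to be non-torsion
  have hPnt : ¬ IsOfFinAddOrder P :=
    AcPConverseLinks.not_isOfFinAddOrder_of_links (congruentNumberCurve n) 2 κ vbar γ ι P
      (hA hsq K ((congruentNumberCurve n).conductorNorm ℤ) rfl hK hHN hH2 ι
        (Summit.BirchSwinnertonDyer.Rank1Residual.X11b.inducedPlace ι) vbar hv hvbar hne κ hκ γ hcK)
      (hB hsq K ((congruentNumberCurve n).conductorNorm ℤ) rfl hK hHN hH2 ι
        (Summit.BirchSwinnertonDyer.Rank1Residual.X11b.inducedPlace ι) vbar hv hvbar hne κ hκ γ hcK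
        P hP)
  -- Mordell–Weil over `K`, descent by the rank equality
  have hrkK : 1 ≤ ((congruentNumberCurve n).baseChange K).mordellWeilRank :=
    one_le_mordellWeilRank_of_not_isOfFinAddOrder _
      ((congruentNumberCurve n).baseChange K).module_finite_point_holds hPnt
  rwa [hrk] at hrkK

/-- **Crux A `RankPosOfTwoSelmerCorankOne` from the two `2`-adic links and five refereed facts**
(square-free reduction by the tree theorem `rankPosOfTwoSelmerCorankOne_of_squarefree`, p419178).
CONDITIONAL on the two open links; credits nothing.
[cite: CastellaGrossiLeeSkinner2022, §5.2 (proof of Thm. 5.2.1)] -/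
theorem cruxA_of_twoAdicLinks
    (hpar : ∀ (W : WeierstrassCurve ℚ) [W.IsElliptic] (p : ℕ) [Fact p.Prime], p_parity W p)
    (hmod : ModularForms.exists_isNewformOf) (hHL : HoffsteinLuo1997_exists_twist_L_one_ne_zero)
    (hKato : ∀ (W : WeierstrassCurve ℚ) [W.IsElliptic] (p : ℕ) [Fact p.Prime],
      kato_finite_of_L_one_ne_zero W p)
    (hHP : ∀ (W : WeierstrassCurve ℚ) (K : Type) [Field K] [NumberField K],
      exists_isHeegnerPoint W K)
    (hA : TwoAdicControlOfCorankOne) (hB : TwoAdicCharValueEqHeegnerLogSq) :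
    RankPosOfTwoSelmerCorankOne :=
  CongruentShaFreeCutRankPosSquarefreeReduction.rankPosOfTwoSelmerCorankOne_of_squarefree
    (rankPos_squarefree_of_twoAdicLinks hpar hmod hHL hKato hHP hA hB)

/-! ## 4. The whole rung-S2 leaf from the two links (PROVED composition) -/

/-- **The rung-S2 leaf `rankOne_twoConverse_congruentNumber` from the TWO typed `2`-adic links**
(corank form of Link A, Link B) **and refereed facts** — `2`-parity, modularity, Hoffstein–Luo, Kato,
Gross's Heegner points, Gross–Zagier + Kolyvagin (`hGZ`): crux A by `cruxA_of_twoAdicLinks`, crux B by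
the typer's `cruxB_of_twoAdicLinks` (Link A in rank form follows from the corank form), and the
route's `Assembly` (`CongruentShaFreeCutAssembly.assembly_holds`). CONDITIONAL on the two open links;
credits nothing; BSD is not touched. [cite: GrossZagier1986, Thm. I.6.3 with V.§2]
[cite: CastellaGrossiLeeSkinner2022, §5.2 (proof of Thm. 5.2.1)] -/
theorem leaf_of_twoAdicLinks
    (hpar : ∀ (W : WeierstrassCurve ℚ) [W.IsElliptic] (p : ℕ) [Fact p.Prime], p_parity W p)
    (hmod : ModularForms.exists_isNewformOf) (hHL : HoffsteinLuo1997_exists_twist_L_one_ne_zero)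
    (hKato : ∀ (W : WeierstrassCurve ℚ) [W.IsElliptic] (p : ℕ) [Fact p.Prime],
      kato_finite_of_L_one_ne_zero W p)
    (hHP : ∀ (W : WeierstrassCurve ℚ) (K : Type) [Field K] [NumberField K],
      exists_isHeegnerPoint W K)
    (hGZ : ∀ (W : WeierstrassCurve ℚ) (N : ℕ) [NeZero N] (K : Type) [Field K] [NumberField K],
      analyticRankEK_eq_one_iff_heegner_nonTorsion W N K)
    (hA : TwoAdicControlOfCorankOne) (hB : TwoAdicCharValueEqHeegnerLogSq) :
    rankOne_twoConverse_congruentNumber :=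
  CongruentShaFreeCutAssembly.assembly_holds (cruxA_of_twoAdicLinks hpar hmod hHL hKato hHP hA hB)
    (cruxB_of_twoAdicLinks hpar hmod hHL hKato hHP hGZ (twoAdicControlOfRankOne_of_corankOne hA) hB)

end Summit.BirchSwinnertonDyer.BirchSwinnertonDyer.Theorems.CongruentShaFreeCutTwoAdicLinksCorank

end
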